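import Summits.QuantumFields.YangMills.Theorems.BalabanUVNodesN22W1RelCentredSliceInputsLGU
import Literature.MathematicalPhysics.QuantumFieldTheory.Balaban1983to89.Node00.HistoryTermDatum214OlderReading

/-!
# BalabanUVNodes ∕ node N22 = NE9 — THE RELATIVE-DISC CENTRED ROAD OVER THE ADMISSIBLE CLASS, MODULE J15: THE OLDER-TERMS LAWS OF THE UNIFORM RECORD `SliceInputsLGU` FROM
# node00-def-W1 W1-17's READING OF THE HISTORY — the record's four located inputs on the older-terms potential `𝒪` (`h𝒪m`, `h𝒪d`, `hloc𝒪`, `hOhol`) are THEOREMS for a potential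
# READ by `ReadingAtoms` obeying W1-17's displayed laws ([II] Lemma 1 (1.33)–(1.35) p. 9, Lemma 2 (1.41) p. 11; [I] (3.4) p. 270, (3.10) p. 272, (3.15)–(3.18) p. 273, §1 p. 263)

Cell `pub-ymgap`, HUMAN RULING D-0062 (Track A), R134 ACCELERATION re-seat `pub-ymgap-dag-n22-c` (strategy s1), generation 9, file J15.  THEOREMS ONLY; imports J12-D `…SliceInputsLGU`
(the uniform ∕ primitive located-input record, p567268) and node00-def-W1 W1-17 `Node00/HistoryTermDatum214OlderReading` (p569575: `ReadingAtoms`, the laws `MapsToTables` ∕ `CfgHoloOn` ∕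
`CfgJointContinuous` ∕ `KernelBounded` ∕ `FiniteMass` ∕ `LocalIn`, the schema `ReadsOnBy`, and the transfer faces `ReadsOnBy.measurable_field ∕ differentiableOn_config ∕ local_of_localIn ∕
differentiableOn_history`) BY NAME.  `--supports` K3⁷ `SpineGivenEndpointR13SepCoPH` (stmt-QuantumFields-20544) as a helper.

WHY.  J12-D's record asks, per slice, on the OPAQUE older-terms potential `𝒪 : 𝔇.UnscaledOlder` of W1-11's unscaled-field law, four located inputs at every admissible history:
measurability in the field (`h𝒪m`), holomorphy in the configuration on the thickening (`h𝒪d`, the primitive φ-law), `S₀`-locality (`hloc𝒪`) and holomorphy along admissible history curves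
(`hOhol`).  Print's `𝒪` is not an arbitrary functional of the history: it READS the older terms `E^{(j)}(X; ·)` at configurations moving analytically with `ξ` ([I] (3.10), [II] (1.41));
W1-17 typed that reading (`ReadingAtoms`, `readOlder`, `ReadsOnBy`) with its laws and proved the four properties for read potentials by dominated parametric integrals (def-W1 g22's
consumer scratch against J12-D's binders, bus 2026-08-27 20:36Z; this seat's ANSWER YES l.≈23130).  THIS FILE is the consumer-side face: for an `𝒪` READ on the admissible class of the
record's tables, on the thickening `W` and on every field (`𝔅 := univ` — the CLAMPED reading; print's located box `ReadingAtoms.FieldBox S₀ ρ` is W1-17's producer-facing preference,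
and every consumer in the tree reads `𝒪` only at clipped fields, so a producer meets the all-field quantifiers of J12-D by clamping the configuration family outside the box, where the
small-field characteristic function vanishes — W1-17 §2 docstring), the four record fields hold VERBATIM, binder for binder (`spaceOfRecord … j X = spaceI …` and `(domSys P M j).dj X =
torusTreeLen X.1` by `rfl`).

WHAT.  ★ `SliceInputsLGU.olderLaws_of_readsOnBy` — from `𝔇.ReadsOnBy 𝒪 Z t R (AdmHist (spaceOfRecord Sg Rz α₀ α₁) E₀ κ_E k) W univ` + `IsOpen W` + the five laws (`MapsToTables`, `CfgHoloOn`,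
`CfgJointContinuous`, `KernelBounded C`, `FiniteMass m`) + `LocalIn S₀`: the CONJUNCTION of the four field statements of `SliceInputsLGU … W …` (`h𝒪m` ∧ `h𝒪d` ∧ `hloc𝒪` ∧ `hOhol`, in the
record's binder shapes), each ONE application of a W1-17 transfer face; `…_readOlder` — the same for `𝒪 := 𝔇.readOlder R` (`readsBy_readOlder`); `crude_h0_of_readsOnBy` — the (L0)-SHAPE at zero field with W1-17's UNLOCALIZED constant
(`norm_potential_le_of_sizeAdm`; NOT print's (1.36)).  A producer of the record at a read datum writes `h𝒪m := (olderLaws_of_readsOnBy …).1`, etc.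

HONEST FRAMING.  Count-neutral bookkeeping (four `exact`s); the READING WITH ITS LAWS at the datum OF RECORD (NODE A's interpolation ∕ Cauchy atoms of [I] (3.4)∕(3.10)∕(3.15), [II]
(1.10)∕(1.23)) is the PRODUCER's — nothing of it is constructed here; the letters `h0 ∕ h4 ∕ h5 ∕ h6`, the linear part `D𝒪` and print's (1.36)∕(1.42) estimates stay located inputs; N22
NOT discharged; one finite four-torus programme at fixed ε — NOT infinite volume, NOT OS on ℝ⁴, NOT a mass gap, NOT Clay.  0 `sorry`, 0 `def`, standard axioms.

References (TYPES only): [II] = [Balaban1988RG2Cluster] (1.10) p. 4, (1.23) p. 7, Lemma 1 (1.33)–(1.35) p. 9, Lemma 2 (1.41)–(1.42) p. 11, (2.2)–(2.3) p. 12, (2.14) p. 15 ll. 19–20;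
[I] = [Balaban1987RG1] §1 p. 263, (3.3)–(3.4) p. 270, (3.10) p. 272, (3.15)–(3.18) p. 273.
-/

noncomputable section

namespace YMDAG.N22.W1

open Set Metric Matrix
open Literature.MathematicalPhysics.QuantumFieldTheory.Balaban1983to89
open Literature.MathematicalPhysics.QuantumFieldTheory.Balaban1983to89.TreeLengthTorus (TPt TDom tsys torusTreeLen)
open Literature.MathematicalPhysics.QuantumFieldTheory.Balaban1983to89.Step (SFConsts)
open Literature.MathematicalPhysics.QuantumFieldTheory.Balaban1983to89.Node00.Sect2 (domSys domCount CPair spaceI domSites Setting Residual)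
open Literature.MathematicalPhysics.QuantumFieldTheory.Balaban1983to89.Node00.W1

namespace SliceInputsLGU

variable {c₀ : B13.Consts} {P : Params} {𝔸 : Type*} [NormedRing 𝔸] [NormedAlgebra ℂ 𝔸] [CompleteSpace 𝔸] {M k L : ℕ} [NeZero L]
  {𝔇 : TermDatum214 c₀ P 𝔸 M k L}
  (𝒪 : (Z : (domSys P M (k + 1)).Dom) → (t : TermLabel P M k L) → OlderTerms P 𝔸 M k → CPair P 𝔸 → TDom P.d (L * domCount P M (k + 1)) →
    ((𝔇.𝒦 Z t).Λ → ℝ) → ℂ)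
  {G : Type*} [GaugeGroup G] (Sg : Setting 𝔸 G) (Rz : Residual P 𝔸) (cs : SFConsts) (E₀ κE : ℝ)
  (Z : (domSys P M (k + 1)).Dom) (t : TermLabel P M k L) {W : Set (CPair P 𝔸)}
  {S : Type*} [MeasurableSpace S] [TopologicalSpace S] [OpensMeasurableSpace S] {R : 𝔇.ReadingAtoms Z t S} {C m : ℝ} {S₀ : Set (𝔇.𝒦 Z t).Λ}

/-- **★ THE OLDER-TERMS LAWS OF THE UNIFORM RECORD FROM A READING OF THE HISTORY** — if the older-terms potential `𝒪` is READ at the slice `(Z, t)` by reading atoms `R` on the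
admissible class of the record's tables, on the thickening `W` and on every field (W1-17 `ReadsOnBy … (AdmHist (spaceOfRecord Sg Rz α₀ α₁) E₀ κ_E k) W univ`), `W` is open, the
configuration families stay in the tables, move analytically with the configuration and jointly continuously with (field, parameter), the kernels are bounded measurable, the measures
finite, and the families read the field only in `S₀` — then the four older-terms fields of `SliceInputsLGU 𝔇 χᵘ χᶜᵘ 𝒲 𝒪 c Sg Rz cs E₀ κ_E Z t W …` hold, in the record's binder shapes:
`h𝒪m` (measurability in the field), `h𝒪d` (the primitive φ-law), `hloc𝒪` (`S₀`-locality), `hOhol` (holomorphy along admissible history curves).  One W1-17 transfer face each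
(`ReadsOnBy.measurable_field ∕ differentiableOn_config ∕ local_of_localIn ∕ differentiableOn_history`); the tables and tree lengths match by `rfl`.
[cite: Balaban1988RG2Cluster, Lemma 1 (1.33)-(1.35) p.9, Lemma 2 (1.41) p.11, (2.2)-(2.3) p.12 and (2.14) p.15 ll.19-20; Balaban1987RG1, §1 p.263, (3.4) p.270, (3.10) p.272 and (3.15)-(3.18) p.273] -/
theorem olderLaws_of_readsOnBy
    (h : 𝔇.ReadsOnBy 𝒪 Z t R (AdmHist (spaceOfRecord (M := M) Sg Rz (fun _ => cs.α₀) (fun _ => cs.α₁)) E₀ κE k) W univ) (hW : IsOpen W)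
    (hmaps : R.MapsToTables (fun j X => spaceI Sg Rz M j (domSites P M j X) cs.α₀ cs.α₁) W univ) (hhol : R.CfgHoloOn W univ)
    (hjc : R.CfgJointContinuous) (hK : R.KernelBounded C) (hμ : R.FiniteMass m) (hloc : R.LocalIn S₀) :
    (∀ old : OlderTerms P 𝔸 M k, old ∈ AdmHist (spaceOfRecord (M := M) Sg Rz (fun _ => cs.α₀) (fun _ => cs.α₁)) E₀ κE k →
        ∀ ξ ∈ W, ∀ Y : TDom P.d (L * domCount P M (k + 1)), Measurable (𝒪 Z t old ξ Y)) ∧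
      (∀ old : OlderTerms P 𝔸 M k, old ∈ AdmHist (spaceOfRecord (M := M) Sg Rz (fun _ => cs.α₀) (fun _ => cs.α₁)) E₀ κE k →
        ∀ (Y : TDom P.d (L * domCount P M (k + 1))) (A : (𝔇.𝒦 Z t).Λ → ℝ), DifferentiableOn ℂ (fun ξ : CPair P 𝔸 => 𝒪 Z t old ξ Y A) W) ∧
      (∀ old : OlderTerms P 𝔸 M k, old ∈ AdmHist (spaceOfRecord (M := M) Sg Rz (fun _ => cs.α₀) (fun _ => cs.α₁)) E₀ κE k →
        ∀ ξ ∈ W, ∀ Y ∈ t.1, ∀ A A' : (𝔇.𝒦 Z t).Λ → ℝ, (∀ b ∈ S₀, A b = A' b) → 𝒪 Z t old ξ Y A = 𝒪 Z t old ξ Y A') ∧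
      (∀ ξ ∈ W, ∀ (O : Set ℂ), IsOpen O → ∀ cv : ℂ → OlderTerms P 𝔸 M k,
        (∀ (j : Fin (k + 1)) (Y : (domSys P M j).Dom) (ψ : CPair P 𝔸), ψ ∈ spaceI Sg Rz M j (domSites P M j Y) cs.α₀ cs.α₁ →
          DifferentiableOn ℂ (fun z => cv z j Y ψ) O ∧ ∀ z ∈ O, ‖cv z j Y ψ‖ ≤ E₀ * Real.exp (-(κE * torusTreeLen Y.1))) →
        (∀ z ∈ O, ∀ (j : Fin (k + 1)) (Y : (domSys P M j).Dom), AnalyticOnNhd ℂ (cv z j Y) (spaceI Sg Rz M j (domSites P M j Y) cs.α₀ cs.α₁)) →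
        ∀ (Y : TDom P.d (L * domCount P M (k + 1))) (A : (𝔇.𝒦 Z t).Λ → ℝ), DifferentiableOn ℂ (fun z => 𝒪 Z t (cv z) ξ Y A) O) :=
  ⟨fun _ hold _ hξ Y => h.measurable_field hmaps hjc hK hμ hold hξ Y,
    fun _ hold Y A => h.differentiableOn_config hW hmaps hhol hjc.cfgContinuous hK hμ hold Y (mem_univ A),
    fun _ hold _ hξ _ hY _ _ hAA' => h.local_of_localIn hloc hold hξ hY (mem_univ _) (mem_univ _) hAA',
    fun _ hξ _ hO _ hcv hcvA Y A => h.differentiableOn_history hO hmaps hjc.cfgContinuous hK hμ hξ hcv hcvA Y (mem_univ A)⟩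

/-- **The same for the potential READ BY a family of readings** (`𝒪 := 𝔇.readOlder Rf`, W1-17 `readsBy_readOlder`): the four older-terms fields of the uniform record hold at every
slice. [cite: Balaban1988RG2Cluster, Lemma 2 (1.41) p.11 and (2.14) p.15 ll.19-20; Balaban1987RG1, §1 p.263 and (3.10) p.272] -/
theorem olderLaws_readOlder (Rf : (Z : (domSys P M (k + 1)).Dom) → (t : TermLabel P M k L) → 𝔇.ReadingAtoms Z t S) (hW : IsOpen W)
    (hmaps : (Rf Z t).MapsToTables (fun j X => spaceI Sg Rz M j (domSites P M j X) cs.α₀ cs.α₁) W univ) (hhol : (Rf Z t).CfgHoloOn W univ)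
    (hjc : (Rf Z t).CfgJointContinuous) (hK : (Rf Z t).KernelBounded C) (hμ : (Rf Z t).FiniteMass m) (hloc : (Rf Z t).LocalIn S₀) :
    (∀ old : OlderTerms P 𝔸 M k, old ∈ AdmHist (spaceOfRecord (M := M) Sg Rz (fun _ => cs.α₀) (fun _ => cs.α₁)) E₀ κE k →
        ∀ ξ ∈ W, ∀ Y : TDom P.d (L * domCount P M (k + 1)), Measurable (𝔇.readOlder Rf Z t old ξ Y)) ∧
      (∀ old : OlderTerms P 𝔸 M k, old ∈ AdmHist (spaceOfRecord (M := M) Sg Rz (fun _ => cs.α₀) (fun _ => cs.α₁)) E₀ κE k →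
        ∀ (Y : TDom P.d (L * domCount P M (k + 1))) (A : (𝔇.𝒦 Z t).Λ → ℝ), DifferentiableOn ℂ (fun ξ : CPair P 𝔸 => 𝔇.readOlder Rf Z t old ξ Y A) W) ∧
      (∀ old : OlderTerms P 𝔸 M k, old ∈ AdmHist (spaceOfRecord (M := M) Sg Rz (fun _ => cs.α₀) (fun _ => cs.α₁)) E₀ κE k →
        ∀ ξ ∈ W, ∀ Y ∈ t.1, ∀ A A' : (𝔇.𝒦 Z t).Λ → ℝ, (∀ b ∈ S₀, A b = A' b) → 𝔇.readOlder Rf Z t old ξ Y A = 𝔇.readOlder Rf Z t old ξ Y A') ∧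
      (∀ ξ ∈ W, ∀ (O : Set ℂ), IsOpen O → ∀ cv : ℂ → OlderTerms P 𝔸 M k,
        (∀ (j : Fin (k + 1)) (Y : (domSys P M j).Dom) (ψ : CPair P 𝔸), ψ ∈ spaceI Sg Rz M j (domSites P M j Y) cs.α₀ cs.α₁ →
          DifferentiableOn ℂ (fun z => cv z j Y ψ) O ∧ ∀ z ∈ O, ‖cv z j Y ψ‖ ≤ E₀ * Real.exp (-(κE * torusTreeLen Y.1))) →
        (∀ z ∈ O, ∀ (j : Fin (k + 1)) (Y : (domSys P M j).Dom), AnalyticOnNhd ℂ (cv z j Y) (spaceI Sg Rz M j (domSites P M j Y) cs.α₀ cs.α₁)) →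
        ∀ (Y : TDom P.d (L * domCount P M (k + 1))) (A : (𝔇.𝒦 Z t).Λ → ℝ), DifferentiableOn ℂ (fun z => 𝔇.readOlder Rf Z t (cv z) ξ Y A) O) :=
  olderLaws_of_readsOnBy (𝔇.readOlder Rf) Sg Rz cs E₀ κE Z t ((TermDatum214.readsBy_readOlder Rf).readsOnBy Z t _ _ _) hW hmaps hhol hjc hK hμ hloc

omit [TopologicalSpace S] [OpensMeasurableSpace S] in
/-- **The CRUDE (L0)-shape of a read potential at zero field** (W1-17 `norm_potential_le_of_sizeAdm` transferred): for an `𝒪` read on the admissible class, every admissible history and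
every `ξ ∈ W`, `‖𝒪(old, ξ; Y, 0)‖ ≤ Σ_{j ≤ k} Σ_{X ∈ 𝐃_j} C·E₀e^{−κ_E d_j(X)}·m` — a `Y`-INDEPENDENT constant, i.e. the record's `h0` letter `c₀(Y)` in UNLOCALIZED form.  HONEST: this is
NOT print's (1.36) (which carries the decay `e^{−κ d_k(Y)}` that makes the closure `Σ_Y R(Y)c₀(Y) ≤ w₀` volume-free); the localized letter stays N10's ∕ the producer's.
[cite: Balaban1987RG1, (1.18) p.263; Balaban1988RG2Cluster, (1.36) p.9 (crude form only) and Lemma 2 (1.41) p.11] -/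
theorem crude_h0_of_readsOnBy
    (h : 𝔇.ReadsOnBy 𝒪 Z t R (AdmHist (spaceOfRecord (M := M) Sg Rz (fun _ => cs.α₀) (fun _ => cs.α₁)) E₀ κE k) W univ) (hC : 0 ≤ C) (hE₀ : 0 ≤ E₀)
    (hmaps : R.MapsToTables (fun j X => spaceI Sg Rz M j (domSites P M j X) cs.α₀ cs.α₁) W univ) (hK : R.KernelBounded C) (hμ : R.FiniteMass m) :
    ∀ old : OlderTerms P 𝔸 M k, old ∈ AdmHist (spaceOfRecord (M := M) Sg Rz (fun _ => cs.α₀) (fun _ => cs.α₁)) E₀ κE k → ∀ ξ ∈ W,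
      ∀ Y : TDom P.d (L * domCount P M (k + 1)),
        ‖𝒪 Z t old ξ Y 0‖ ≤ ∑ j : Fin (k + 1), ∑ X : (domSys P M j).Dom, C * (E₀ * Real.exp (-(κE * (domSys P M j).dj X))) * m := by
  intro old hold ξ hξ Y
  rw [h old hold ξ hξ Y 0 (mem_univ _)]
  exact R.norm_potential_le_of_sizeAdm hC hE₀ hmaps hK hμ hold.1 hξ Y (mem_univ _)

end SliceInputsLGU

end YMDAG.N22.W1

end
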